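/-
Copyright (c) 2026 the pub-hodgecm-mathlib formalisation cell (harness21).  Prover seat hodgecm-mathlib-F0P3a-p01 (g33), req620 Track A «(D-RAM) FOUR-FRAME» squad, unit U2H:
the (ρ2b′-X) child (U2H ED. 15 :418) — organ O-Lit brick 2 (wild anisotropic literal), file (δ) «THE ANISOTROPIC LITERAL `Y = P·ι(C⁻¹gC, u)·P⁻¹ ∈ U(σ_w, J₀)` AT A WILD PLACE»
(PLAN v1 04:56Z; MAP v1 seams S3∕S5; payer lineage LH4-p14).  2026-09-04.
-/
import Summits.HodgeConjecture.HodgeConjecture.Theorems.F0P3cDyRamWildIntegralDress          -- (γ) `exists_glInt_formCongr_antidiagonal_eq_wild`; brings ★ endoGL, formCongr, lattice tree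
import Summits.HodgeConjecture.HodgeConjecture.Theorems.F0P3cDyRamTypeTwoLiteralSignWild       -- ★ brick 1 p857204: `norm_dichotomy_of_not_norm_anyPlace` (index two of the norm group, any place)
import Literature.NumberTheory.Rogawski1990.TypeTwoAnisotropicLiteralRamified                   -- ★ tame sibling: `det_endoForm`, `endoForm_apply_one_one`, `oneByOne_map_transpose`
import Literature.NumberTheory.LocalFields.WildQuadraticDatumNonNormUnit                        -- ★ `exists_fixed_unit_not_norm_of_isRamifiedQuadraticDatum` (a σ-fixed non-norm UNIT, any `|2|`)
import Literature.NumberTheory.Automorphic.UnitaryThreeFourFrameDefs                            -- ★ `IsRamifiedQuadraticDatum`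
import Literature.NumberTheory.Automorphic.AdicCompletionIntegersAdicComplete                   -- ★ `isAdicComplete_valuedMaximalIdeal_valuedInteger_adicCompletion`
import Literature.NumberTheory.Automorphic.LocalHermitianPlaneAnisotropic                       -- ★ `exists_formCongr_eq_diagTwo_of_hermForm_self_ne_zero`
import Literature.NumberTheory.Automorphic.LocalHermitianPlaneCongruence                        -- ★ `exists_hermForm_self_ne_zero_two`, `det_formCongr_eq_mul_norm`
import Literature.NumberTheory.Automorphic.UnitaryGroupSelfDualLocus                            -- ★ `formCongr_hermitian`
import Literature.NumberTheory.Automorphic.UnitaryThreeFourFrameLiteralUnitary                  -- ★ `formCongr_apply_eq_pairing`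
import Literature.NumberTheory.Automorphic.EllipticPlaneAsFieldLineHermitian                    -- ★ `pairing_single_single`
import HarnessLib

/-!
# Crux `H413`, line LH4 «(D-RAM) FOUR-FRAME» road — unit U2H, (ρ2b′-X), organ O-Lit brick 2, file (δ): THE WILD ANISOTROPIC LITERAL IN `U(σ_w, J₀)`

Cell `hodgecm-mathlib` (D-0151), FLOOR 0, crux item H413 = `stmt-HodgeConjecture-24833`, route of record `HCCMUnconditional`; squad F0∕P3c∕LH4; registered stub served:
`F0P3cDyRamFourFrameU2H.stub_U2H_fixedPointCensus_typeTwo_unit0` ((ρ2b′-X), U2H ED. 15 :418) through the organs of RHO2BX-ORDER v1 (payer LH4-p14; MAP v1 seams S3 «O-Lit: ta» and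
S5 «N(ta)»).  THEOREMS ONLY (no `def`, no instance, no notation, no `sorry`); lane `--supports stmt-HodgeConjecture-24833 --as helper` (count-neutral).

WHAT THIS FILE DOES — the 2-FREE twin of the tame ★ `TypeTwoAnisotropicLiteralRamified.exists_anisotropicLiteral_ram` (which needs `|2|_w = 1` three times: the signed generator,
the non-norm `η`, the integral dress ★ p846940).  At a ramified non-split CM place `w ∣ v` carrying a ramified quadratic datum `(σ_w, ϖ, d, t_E)` (ANY residue characteristic),
for `g ∈ GL₂(L_w)` unitary for a hermitian PARTNER plane `Ψ₀` whose determinant class differs from that of `Φ₂ = antidiag(1,1)` by a NON-NORM `ν` (`det Ψ₀ = det Φ₂·ν`; files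
(α) `F0P3cDyRamPartnerPlane` + (β) `F0P3cDyRamPartnerTwistScalar` supply such a `Ψ₀` for every type-(2) `g ∈ U(Φ₂)` from the line model), and every `u ∈ GL₁(L_w)` with
`σu·u = 1`:
* §1 helpers: `mem_unitaryGroupOfForm_of_pairing` (pairing-invariance ⇒ `g ∈ U(Ψ)`), `formCongr_diagGL_diagTwo` (rescaling a diagonal plane), `exists_v_norm_mul_eq_one`
  (`σ_w`-fixed `b ≠ 0` ⇒ `|σz·z·b| = 1` for some `z`), `endoGL_mulVec_single_one`, `det_ne_zero_col`.
* §2 **`exists_anisotropicLiteral_wild_of_partner`** — there are `P ∈ GL₃(𝒪_w)`, `C ∈ GL₂(L_w)`, a UNIMODULAR DIAGONAL `Ψ = diag(d₀, d₁)` (`σdᵢ = dᵢ`, `|dᵢ| = 1`) with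
  `C⁻¹gC ∈ U(Ψ)`, and a `σ_w`-fixed UNIT `a₁` which is NOT a norm, such that `ᵗσ̄P·J₀·P = endoForm Ψ (a₁)` (file (γ)), `Y := P·endoGL(C⁻¹gC, u)·P⁻¹ ∈ U(σ_w, J₀)` is
  `GL₃(L_w)`-conjugate to the endoscopic pattern `endoGL(g, u)`, and `q := P e₁` satisfies `Y q = u·q`, `q ≠ 0`, `J₀`-length `Σ σ(qᵢ)(J₀)ᵢₖ q_k = a₁` — the binders of ★ brick 1
  `finKappaAt_eq_neg_hilbertSymbol_of_nonNorm_length_anyPlace` (κ = −(y_λ, θ)_v) and the block letters `(P, Ψ, C⁻¹gC, a₁)` of MAP S5's form transport.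
HONEST LABEL.  Count-neutral helper; (ρ2b′-X) stays an OPEN prover target; `HC_CM` is proved only modulo the 7 printed citations (2 remaining named inputs: hLiu418 =
`stmt-HodgeConjecture-24832`, h413 = `stmt-HodgeConjecture-24833`) until rung 0 closes.

## References
* [Rogawski1990] J. D. Rogawski, *Automorphic Representations of Unitary Groups in Three Variables*, Ann. of Math. Stud. 123 (1990), §3.5 Prop. 3.5.2 (a)(c) p. 29, §3.6 p. 31,
  §4.8 Case (a) p. 53, §4.9 Prop. 4.9.1 p. 55 (the two classes of matches of a type-(2) element and their `κ`-signs).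
* [LabesseLanglands1979] J.-P. Labesse, R. P. Langlands, *L-indistinguishability for SL(2)*, Canad. J. Math. 31 (1979), §2 pp. 8–10.
* [Jacobowitz1962] R. Jacobowitz, *Hermitian forms over local fields*, Amer. J. Math. 84 (1962), §3 Thm. 3.1, §8, §10 Prop. 10.3.
* [Serre1979] J.-P. Serre, *Local Fields*, GTM 67 (1979), Ch. V §3 Cor. 2–3 (`[U_F : N U_E] = 2` at a ramified quadratic extension).
-/

set_option autoImplicit false

noncomputable section

open NumberField IsDedekindDomain Matrix
open Literature.NumberTheory.Automorphic Literature.NumberTheory.Automorphic.UnitaryGroup Literature.NumberTheory.Automorphic.UnitaryLatticeTree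
open Literature.NumberTheory.Rogawski1990 Literature.NumberTheory.Automorphic.UnitaryThreeFourFrame
open scoped MatrixGroups ValuativeRel

namespace Summit.HodgeConjecture.HodgeConjecture.Cruxes.H413.F0P3cDyRamTypeTwoAnisotropicLiteralWild

/-! ## §1 Helpers over a field with involution -/

section Field

variable {K : Type} [Field K] (σ : K →+* K)

/-- Pairing-invariance on all vectors puts `g` in the unitary group of the Gram matrix. [cite: Jacobowitz1962, §3] -/
theorem mem_unitaryGroupOfForm_of_pairing (Ψ : Matrix (Fin 2) (Fin 2) K) (g : GL (Fin 2) K)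
    (hg : ∀ x y, pairing σ Ψ ((g : Matrix (Fin 2) (Fin 2) K).mulVec x) ((g : Matrix (Fin 2) (Fin 2) K).mulVec y) = pairing σ Ψ x y) :
    g ∈ unitaryGroupOfForm σ Ψ := by
  rw [mem_unitaryGroupOfForm_iff]
  refine Matrix.ext fun i j => ?_
  calc (((g : Matrix (Fin 2) (Fin 2) K).map σ)ᵀ * Ψ * (g : Matrix (Fin 2) (Fin 2) K)) i j = formCongr σ g Ψ i j := rfl
    _ = pairing σ Ψ (fun a => (g : Matrix (Fin 2) (Fin 2) K) a i) (fun a => (g : Matrix (Fin 2) (Fin 2) K) a j) := formCongr_apply_eq_pairing σ g Ψ i j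
    _ = pairing σ Ψ ((g : Matrix (Fin 2) (Fin 2) K).mulVec (Pi.single i 1)) ((g : Matrix (Fin 2) (Fin 2) K).mulVec (Pi.single j 1)) := by
          rw [Matrix.mulVec_single_one, Matrix.mulVec_single_one]; rfl
    _ = pairing σ Ψ (Pi.single i 1) (Pi.single j 1) := hg _ _
    _ = Ψ i j := Literature.NumberTheory.Automorphic.EllipticPlaneAsFieldLine.pairing_single_single σ Ψ i j

/-- Rescaling a diagonal plane: `ᵗσ̄(diag z)·diag(b₀, b₁)·diag z = diag(σz₀ b₀ z₀, σz₁ b₁ z₁)`. [cite: Jacobowitz1962, §8] -/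
theorem formCongr_diagTwo (D : GL (Fin 2) K) {z₀ z₁ : K} (hD : (D : Matrix (Fin 2) (Fin 2) K) = !![z₀, 0; 0, z₁]) (b₀ b₁ : K) :
    formCongr σ D !![b₀, 0; 0, b₁] = !![σ z₀ * b₀ * z₀, 0; 0, σ z₁ * b₁ * z₁] := by
  change ((D : Matrix (Fin 2) (Fin 2) K).map σ)ᵀ * !![b₀, 0; 0, b₁] * (D : Matrix (Fin 2) (Fin 2) K) = _
  rw [hD]
  ext i j; fin_cases i <;> fin_cases j <;> simp [Matrix.mul_apply, Fin.sum_univ_two]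

/-- The middle column of the endoscopic pattern: `endoGL(G₁, u)·e₁ = u·e₁`. [cite: Rogawski1990, §4.8 Case (a) p. 53] -/
theorem endoGL_mulVec_single_one (G₁ : GL (Fin 2) K) (uu : GL (Fin 1) K) :
    ((endoGL (G₁, uu) : GL (Fin 3) K) : Matrix (Fin 3) (Fin 3) K).mulVec (Pi.single 1 1) = ((uu : Matrix (Fin 1) (Fin 1) K) 0 0) • (Pi.single 1 1 : Fin 3 → K) := by
  rw [coe_endoGL_eq]
  ext k; fin_cases k <;> simp [Matrix.mulVec, dotProduct, Fin.sum_univ_three]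

/-- A column of an invertible matrix is non-zero. [cite: Jacobowitz1962, §3] -/
theorem col_ne_zero (P : GL (Fin 3) K) (j : Fin 3) : (fun k => (P : Matrix (Fin 3) (Fin 3) K) k j) ≠ 0 := by
  intro h0
  have hdet : (P : Matrix (Fin 3) (Fin 3) K).det = 0 :=
    Matrix.det_eq_zero_of_column_eq_zero j fun k => congr_fun h0 k
  have hu : IsUnit (P : Matrix (Fin 3) (Fin 3) K).det := by rw [← Matrix.isUnit_iff_isUnit_det]; exact Units.isUnit P
  exact hu.ne_zero hdet

/-- `P·e_j` is the `j`-th column of `P`. [cite: Jacobowitz1962, §3] -/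
theorem mulVec_single_one_eq_col (P : Matrix (Fin 3) (Fin 3) K) (j : Fin 3) : P.mulVec (Pi.single j 1) = fun k => P k j :=
  Matrix.mulVec_single_one P j

end Field

/-! ## §2 The wild anisotropic literal -/

section CM

variable (L : Type) [Field L] [NumberField L] [IsCMField L] {v : HeightOneSpectrum (𝓞 ↥(maximalRealSubfield L))}
  (w : PlacesOver L v) (hw : IsCMField.complexConj L • w.1 = w.1)

include hw in
/-- **`σ_w`-fixed non-zero elements can be rescaled to units by norms** at a ramified place: `|σ_w z·z·b|_w = 1` for some `z` (their valuations are even). [cite: Serre1979, Ch. V §3] -/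
theorem exists_v_norm_mul_eq_one (he : v.asIdeal.ramificationIdx' w.1.asIdeal ≠ 1) {ϖ : w.1.adicCompletion L} (hϖ : Valued.v ϖ = WithZero.exp (-1 : ℤ))
    {b : w.1.adicCompletion L} (hb : galAdicCompletionMap (L := L) (IsCMField.complexConj L) hw b = b) (hb0 : b ≠ 0) :
    ∃ z : w.1.adicCompletion L, z ≠ 0 ∧ Valued.v (galAdicCompletionMap (L := L) (IsCMField.complexConj L) hw z * b * z) = 1 := by
  obtain ⟨n, hn⟩ := exists_valued_eq_exp_two_mul_of_galAdicCompletionMap_eq_ramifiedCM L v w hw he hb hb0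
  have hϖ0 : ϖ ≠ 0 := fun h0 => by rw [h0, map_zero] at hϖ; exact WithZero.zero_ne_coe hϖ
  refine ⟨ϖ ^ n, zpow_ne_zero n hϖ0, ?_⟩
  rw [map_mul, map_mul, valued_galAdicCompletionMap, map_zpow₀, hϖ, hn, ← WithZero.exp_zsmul, ← WithZero.exp_add, ← WithZero.exp_add, ← WithZero.exp_zero]
  congr 1; simp only [smul_eq_mul]; ring

set_option maxHeartbeats 400000 in
include hw in
/-- **O-Lit brick 2 (δ): THE WILD ANISOTROPIC LITERAL OF A TYPE-(2) ELEMENT, FROM ITS PARTNER PLANE.**  See the module docstring: from `g ∈ U(Ψ₀)` with `det Ψ₀ = det Φ₂·ν`, `ν` a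
`σ_w`-fixed NON-NORM, and `u` with `σu·u = 1`, at a ramified non-split CM place with datum `(σ_w, ϖ, d, t_E)`: `∃ P ∈ GL₃(𝒪_w)`, `C`, `d₀ d₁ a₁` (σ_w-fixed units, `a₁` NOT a
norm) with `ᵗσ̄P J₀ P = endoForm (diag(d₀,d₁)) (a₁)`, `C⁻¹gC ∈ U(diag(d₀,d₁))`, `Y := P·endoGL(C⁻¹gC, u)·P⁻¹ ∈ U(σ_w, J₀)` conjugate to `endoGL(g, u)`, and `q := P e₁` a
`u`-eigenvector of `Y` of `J₀`-length `a₁`. [cite: Rogawski1990, §3.5 Prop. 3.5.2 (a)(c) p. 29; §4.9 Prop. 4.9.1 p. 55] [cite: LabesseLanglands1979, §2 pp. 8–10]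
[cite: Jacobowitz1962, §3 Thm. 3.1; §10 Prop. 10.3] [cite: Serre1979, Ch. V §3 Cor. 2–3] -/
theorem exists_anisotropicLiteral_wild_of_partner (he : v.asIdeal.ramificationIdx' w.1.asIdeal ≠ 1)
    {ϖ : w.1.adicCompletion L} {d tE : ℕ}
    (hD : Literature.NumberTheory.Automorphic.UnitaryThreeFourFrame.IsRamifiedQuadraticDatum (galAdicCompletionMap (L := L) (IsCMField.complexConj L) hw) ϖ d tE)
    (g : GL (Fin 2) (w.1.adicCompletion L)) {Ψ₀ : Matrix (Fin 2) (Fin 2) (w.1.adicCompletion L)}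
    (hΨ₀ : (Ψ₀.map (galAdicCompletionMap (L := L) (IsCMField.complexConj L) hw))ᵀ = Ψ₀) (hgΨ₀ : g ∈ unitaryGroupOfForm (galAdicCompletionMap (L := L) (IsCMField.complexConj L) hw) Ψ₀)
    {ν : w.1.adicCompletion L} (hν : galAdicCompletionMap (L := L) (IsCMField.complexConj L) hw ν = ν)
    (hνN : ¬ ∃ z : w.1.adicCompletion L, galAdicCompletionMap (L := L) (IsCMField.complexConj L) hw z * z = ν)
    (hdetΨ₀ : Ψ₀.det = (!![(0 : w.1.adicCompletion L), 1; 1, 0]).det * ν)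
    (uu : GL (Fin 1) (w.1.adicCompletion L))
    (hu1 : galAdicCompletionMap (L := L) (IsCMField.complexConj L) hw ((uu : Matrix (Fin 1) (Fin 1) (w.1.adicCompletion L)) 0 0) * ((uu : Matrix (Fin 1) (Fin 1) (w.1.adicCompletion L)) 0 0) = 1) :
    ∃ (P : GL (Fin 3) (w.1.adicCompletion L)) (C : GL (Fin 2) (w.1.adicCompletion L)) (d₀ d₁ a₁ : w.1.adicCompletion L),
      P ∈ glInt 3 (w.1.adicCompletion L) ∧
      galAdicCompletionMap (L := L) (IsCMField.complexConj L) hw d₀ = d₀ ∧ galAdicCompletionMap (L := L) (IsCMField.complexConj L) hw d₁ = d₁ ∧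
      Valued.v d₀ = 1 ∧ Valued.v d₁ = 1 ∧
      C⁻¹ * g * C ∈ unitaryGroupOfForm (galAdicCompletionMap (L := L) (IsCMField.complexConj L) hw) !![d₀, 0; 0, d₁] ∧
      galAdicCompletionMap (L := L) (IsCMField.complexConj L) hw a₁ = a₁ ∧ Valued.v a₁ = 1 ∧
      (¬ ∃ t : w.1.adicCompletion L, t * galAdicCompletionMap (L := L) (IsCMField.complexConj L) hw t = a₁) ∧
      formCongr (galAdicCompletionMap (L := L) (IsCMField.complexConj L) hw) P ((StdForm.antidiagonal 3).over (w.1.adicCompletion L)) = endoForm !![d₀, 0; 0, d₁] !![a₁] ∧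
      P * endoGL (C⁻¹ * g * C, uu) * P⁻¹ ∈ unitaryGroupOfForm (galAdicCompletionMap (L := L) (IsCMField.complexConj L) hw) ((StdForm.antidiagonal 3).over (w.1.adicCompletion L)) ∧
      IsConj (endoGL (g, uu)) (P * endoGL (C⁻¹ * g * C, uu) * P⁻¹) ∧
      ((P * endoGL (C⁻¹ * g * C, uu) * P⁻¹ : GL (Fin 3) (w.1.adicCompletion L)) : Matrix (Fin 3) (Fin 3) (w.1.adicCompletion L)).mulVec
          (fun k => (P : Matrix (Fin 3) (Fin 3) (w.1.adicCompletion L)) k 1) =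
        ((uu : Matrix (Fin 1) (Fin 1) (w.1.adicCompletion L)) 0 0) • (fun k => (P : Matrix (Fin 3) (Fin 3) (w.1.adicCompletion L)) k 1) ∧
      (fun k => (P : Matrix (Fin 3) (Fin 3) (w.1.adicCompletion L)) k 1) ≠ 0 ∧
      (∑ i : Fin 3, ∑ k : Fin 3, galAdicCompletionMap (L := L) (IsCMField.complexConj L) hw ((P : Matrix (Fin 3) (Fin 3) (w.1.adicCompletion L)) i 1) *
          (StdForm.antidiagonal 3).over (w.1.adicCompletion L) i k * (P : Matrix (Fin 3) (Fin 3) (w.1.adicCompletion L)) k 1) = a₁ := by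
  classical
  set σ := galAdicCompletionMap (L := L) (IsCMField.complexConj L) hw with hσdef
  set J₀ : Matrix (Fin 3) (Fin 3) (w.1.adicCompletion L) := (StdForm.antidiagonal 3).over (w.1.adicCompletion L) with hJ₀
  have hσσ : ∀ x, σ (σ x) = x := hD.1
  have hvσ : ∀ x, Valued.v (σ x) = Valued.v x := hD.2.1
  have hϖ : Valued.v ϖ = WithZero.exp (-1 : ℤ) := hD.2.2.1
  haveI : CharZero (w.1.adicCompletion L) := charZero_of_injective_algebraMap (algebraMap L (w.1.adicCompletion L)).injective
  have h2 : (2 : w.1.adicCompletion L) ≠ 0 := two_ne_zero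
  haveI := isAdicComplete_valuedMaximalIdeal_valuedInteger_adicCompletion L w.1
  -- the non-norm UNIT `a₁` of the datum
  obtain ⟨a₁, hσa₁, hva₁, ha₁N⟩ := Literature.NumberTheory.LocalFields.WildQuadraticDatum.exists_fixed_unit_not_norm_of_isRamifiedQuadraticDatum σ ϖ d tE hD
  have ha₁0 : a₁ ≠ 0 := fun h0 => by rw [h0, map_zero] at hva₁; exact zero_ne_one hva₁
  -- (1) diagonalise the partner plane and rescale to units
  have hν0 : ν ≠ 0 := fun h0 => hνN ⟨0, by rw [h0, map_zero, zero_mul]⟩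
  have hdetΦ : (!![(0 : w.1.adicCompletion L), 1; 1, 0]).det = -1 := by rw [Matrix.det_fin_two_of]; ring
  have hΨ₀d : Ψ₀.det ≠ 0 := by rw [hdetΨ₀, hdetΦ]; exact mul_ne_zero (by norm_num) hν0
  obtain ⟨x, hx⟩ := exists_hermForm_self_ne_zero_two σ h2 hΨ₀ hΨ₀d
  obtain ⟨B, b₀, hσb₀, hB⟩ := exists_formCongr_eq_diagTwo_of_hermForm_self_ne_zero σ hσσ hΨ₀ rfl hx
  set b₁ := hermForm σ Ψ₀ x x with hb₁
  -- both diagonal entries are σ-fixed and non-zero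
  have hBh : ((formCongr σ B Ψ₀).map σ)ᵀ = formCongr σ B Ψ₀ := formCongr_hermitian σ hσσ B hΨ₀
  have hσb₁ : σ b₁ = b₁ := by
    have h := congr_fun (congr_fun hBh 1) 1
    rw [Matrix.transpose_apply, Matrix.map_apply, hB] at h
    simpa using h
  have hdetB : (formCongr σ B Ψ₀).det = Ψ₀.det * (σ (B : Matrix (Fin 2) (Fin 2) (w.1.adicCompletion L)).det * (B : Matrix (Fin 2) (Fin 2) (w.1.adicCompletion L)).det) :=
    det_formCongr_eq_mul_norm σ B Ψ₀
  have hBd0 : (B : Matrix (Fin 2) (Fin 2) (w.1.adicCompletion L)).det ≠ 0 := by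
    have hu : IsUnit (B : Matrix (Fin 2) (Fin 2) (w.1.adicCompletion L)).det := by rw [← Matrix.isUnit_iff_isUnit_det]; exact Units.isUnit B
    exact hu.ne_zero
  have hb₀b₁ : b₀ * b₁ = Ψ₀.det * (σ (B : Matrix (Fin 2) (Fin 2) (w.1.adicCompletion L)).det * (B : Matrix (Fin 2) (Fin 2) (w.1.adicCompletion L)).det) := by
    rw [← hdetB, hB, Matrix.det_fin_two_of]; ring
  have hb₀0 : b₀ ≠ 0 := by
    intro h0
    have : b₀ * b₁ = 0 := by rw [h0, zero_mul]
    rw [hb₀b₁] at this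
    exact mul_ne_zero hΨ₀d (mul_ne_zero ((map_ne_zero σ).2 hBd0) hBd0) this
  have hb₁0 : b₁ ≠ 0 := hx
  obtain ⟨z₀, hz₀0, hz₀⟩ := exists_v_norm_mul_eq_one L w hw he hϖ hσb₀ hb₀0
  obtain ⟨z₁, hz₁0, hz₁⟩ := exists_v_norm_mul_eq_one L w hw he hϖ hσb₁ hb₁0
  -- the rescaling `D = diag(z₀, z₁)` and `C := B·D`
  have hDdet : (!![z₀, 0; 0, z₁] : Matrix (Fin 2) (Fin 2) (w.1.adicCompletion L)).det ≠ 0 := by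
    rw [Matrix.det_fin_two_of]; simp [hz₀0, hz₁0]
  set D : GL (Fin 2) (w.1.adicCompletion L) := Matrix.GeneralLinearGroup.mkOfDetNeZero _ hDdet with hDdef
  have hDval : (D : Matrix (Fin 2) (Fin 2) (w.1.adicCompletion L)) = !![z₀, 0; 0, z₁] := rfl
  set d₀ : w.1.adicCompletion L := σ z₀ * b₀ * z₀ with hd₀
  set d₁ : w.1.adicCompletion L := σ z₁ * b₁ * z₁ with hd₁
  set C : GL (Fin 2) (w.1.adicCompletion L) := B * D with hCdef
  have hCΨ : formCongr σ C Ψ₀ = !![d₀, 0; 0, d₁] := by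
    rw [hCdef, formCongr_mul, hB, formCongr_diagTwo σ D hDval]
  have hσd₀ : σ d₀ = d₀ := by rw [hd₀, map_mul, map_mul, hσσ, hσb₀]; ring
  have hσd₁ : σ d₁ = d₁ := by rw [hd₁, map_mul, map_mul, hσσ, hσb₁]; ring
  have hvd₀ : Valued.v d₀ = 1 := hz₀
  have hvd₁ : Valued.v d₁ = 1 := hz₁
  -- `C⁻¹ g C` is unitary for `Ψ := diag(d₀, d₁)`
  have hG₁ : C⁻¹ * g * C ∈ unitaryGroupOfForm σ !![d₀, 0; 0, d₁] := by
    have h1 : formCongr σ C⁻¹ (!![d₀, 0; 0, d₁]) = Ψ₀ := by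
      rw [← hCΨ, ← formCongr_mul, mul_inv_cancel]
      change (((1 : GL (Fin 2) (w.1.adicCompletion L)) : Matrix (Fin 2) (Fin 2) (w.1.adicCompletion L)).map σ)ᵀ * Ψ₀ * ((1 : GL (Fin 2) (w.1.adicCompletion L)) : Matrix _ _ _) = Ψ₀
      rw [Units.val_one, Matrix.map_one σ (map_zero σ) (map_one σ), Matrix.transpose_one, Matrix.one_mul, Matrix.mul_one]
    have h := conj_mem_unitaryGroupOfForm σ C⁻¹ (!![d₀, 0; 0, d₁]) (g := g) (by rw [h1]; exact hgΨ₀)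
    rwa [inv_inv] at h
  -- (2) the `3 × 3` dress `H₃ = diag(d₀, d₁) ⊥ (a₁)` and its determinant class
  set H₃ : Matrix (Fin 3) (Fin 3) (w.1.adicCompletion L) := endoForm !![d₀, 0; 0, d₁] !![a₁] with hH₃def
  have hdiagh : ((!![d₀, 0; 0, d₁] : Matrix (Fin 2) (Fin 2) (w.1.adicCompletion L)).map σ)ᵀ = !![d₀, 0; 0, d₁] := by
    ext i j; fin_cases i <;> fin_cases j <;> simp [hσd₀, hσd₁]
  have hH₃h : (H₃.map σ)ᵀ = H₃ := by
    rw [hH₃def, endoForm_map_transpose, hdiagh, oneByOne_map_transpose σ hσa₁]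
  have hH₃int : IsIntMatrix H₃ := by
    intro i j
    rw [hH₃def, endoForm_eq]
    fin_cases i <;> fin_cases j <;> simp [hvd₀.le, hvd₁.le, hva₁.le]
  have hH₃det : H₃.det = d₀ * d₁ * a₁ := by
    rw [hH₃def, det_endoForm, Matrix.det_fin_two_of, Matrix.det_fin_one_of]; ring
  have hvH₃det : Valued.v H₃.det = 1 := by rw [hH₃det, map_mul, map_mul, hvd₀, hvd₁, hva₁, one_mul, one_mul]
  -- `ν·a₁` is a norm (index two: ★ brick 1 §1), so `det H₃` lies in the class of `det J₀ = −1`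
  have ha₁N' : ¬ ∃ t : w.1.adicCompletion L, t * σ t = a₁ := ha₁N
  obtain ⟨zν, hzν0, hνz | hνz⟩ := F0P3cDyRamTypeTwoLiteralSignWild.norm_dichotomy_of_not_norm_anyPlace L w hw hσa₁ ha₁N' ν hν0 hν
  · exact absurd ⟨zν, by rw [mul_comm]; exact hνz.symm⟩ hνN
  have hdetN : ∃ z : w.1.adicCompletion L, z ≠ 0 ∧ H₃.det = J₀.det * (σ z * z) := by
    refine ⟨(C : Matrix (Fin 2) (Fin 2) (w.1.adicCompletion L)).det * (a₁ * zν), mul_ne_zero ?_ (mul_ne_zero ha₁0 hzν0), ?_⟩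
    · have hu : IsUnit (C : Matrix (Fin 2) (Fin 2) (w.1.adicCompletion L)).det := by rw [← Matrix.isUnit_iff_isUnit_det]; exact Units.isUnit C
      exact hu.ne_zero
    · have hd : d₀ * d₁ = Ψ₀.det * (σ (C : Matrix (Fin 2) (Fin 2) (w.1.adicCompletion L)).det * (C : Matrix (Fin 2) (Fin 2) (w.1.adicCompletion L)).det) := by
        have h := det_formCongr_eq_mul_norm σ C Ψ₀
        rw [hCΨ, Matrix.det_fin_two_of] at h
        linear_combination h
      rw [hH₃det, hd, hdetΨ₀, hdetΦ, hJ₀, F0P3cDyRamWildIntegralDress.det_antidiagonal_three, hνz, map_mul, map_mul, hσa₁]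
      ring
  -- (3) the integral dress (γ)
  obtain ⟨P, hPint, hP⟩ := F0P3cDyRamWildIntegralDress.exists_glInt_formCongr_antidiagonal_eq_wild L w hw he hϖ hH₃h hH₃int hvH₃det hdetN
  -- (4) the literal `Y`
  have huU : uu ∈ unitaryGroupOfForm σ (!![a₁] : Matrix (Fin 1) (Fin 1) (w.1.adicCompletion L)) := by
    rw [mem_unitaryGroupOfForm_iff]
    have hmat : (uu : Matrix (Fin 1) (Fin 1) (w.1.adicCompletion L)) = !![(uu : Matrix (Fin 1) (Fin 1) (w.1.adicCompletion L)) 0 0] := by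
      ext i j; fin_cases i; fin_cases j; rfl
    rw [hmat]
    exact oneByOne_map_transpose_mul_mul σ a₁ hu1
  have hEU : endoGL (C⁻¹ * g * C, uu) ∈ unitaryGroupOfForm σ (formCongr σ P J₀) := by
    rw [hJ₀, hP, hH₃def]
    exact (endoGL_mem_iff σ _ _ _ _).2 ⟨hG₁, huU⟩
  have hYU : P * endoGL (C⁻¹ * g * C, uu) * P⁻¹ ∈ unitaryGroupOfForm σ J₀ := conj_mem_unitaryGroupOfForm σ P J₀ hEU
  -- conjugacy to the pattern: `(C⁻¹gC, u) = (C,1)⁻¹ (g,u) (C,1)` in `GL₂ × GL₁`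
  have hconj : IsConj (endoGL (g, uu)) (P * endoGL (C⁻¹ * g * C, uu) * P⁻¹) := by
    refine isConj_iff.2 ⟨P * (endoGL (C, (1 : GL (Fin 1) (w.1.adicCompletion L))))⁻¹, ?_⟩
    have hprod : ((C⁻¹ * g * C, uu) : GL (Fin 2) (w.1.adicCompletion L) × GL (Fin 1) (w.1.adicCompletion L)) =
        (C, (1 : GL (Fin 1) (w.1.adicCompletion L)))⁻¹ * (g, uu) * (C, 1) := by
      rw [Prod.inv_mk, Prod.mk_mul_mk, Prod.mk_mul_mk, inv_one, one_mul, mul_one]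
    rw [hprod, map_mul, map_mul, map_inv]
    group
  -- the `u`-eigenvector `q = P e₁` and its length
  have hcol : (P : Matrix (Fin 3) (Fin 3) (w.1.adicCompletion L)).mulVec (Pi.single 1 1) = fun k => (P : Matrix (Fin 3) (Fin 3) (w.1.adicCompletion L)) k 1 :=
    mulVec_single_one_eq_col _ 1
  have hPPinv : (P : Matrix (Fin 3) (Fin 3) (w.1.adicCompletion L)) * ((P⁻¹ : GL (Fin 3) (w.1.adicCompletion L)) : Matrix (Fin 3) (Fin 3) (w.1.adicCompletion L)) = 1 := by
    rw [← Units.val_mul, mul_inv_cancel, Units.val_one]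
  have hPinvP : ((P⁻¹ : GL (Fin 3) (w.1.adicCompletion L)) : Matrix (Fin 3) (Fin 3) (w.1.adicCompletion L)) * (P : Matrix (Fin 3) (Fin 3) (w.1.adicCompletion L)) = 1 := by
    rw [← Units.val_mul, inv_mul_cancel, Units.val_one]
  have heig : ((P * endoGL (C⁻¹ * g * C, uu) * P⁻¹ : GL (Fin 3) (w.1.adicCompletion L)) : Matrix (Fin 3) (Fin 3) (w.1.adicCompletion L)).mulVec
        (fun k => (P : Matrix (Fin 3) (Fin 3) (w.1.adicCompletion L)) k 1) =
      ((uu : Matrix (Fin 1) (Fin 1) (w.1.adicCompletion L)) 0 0) • (fun k => (P : Matrix (Fin 3) (Fin 3) (w.1.adicCompletion L)) k 1) := by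
    rw [← hcol, Units.val_mul, Units.val_mul, ← Matrix.mulVec_mulVec, ← Matrix.mulVec_mulVec,
      Matrix.mulVec_mulVec (Pi.single 1 1) ((P⁻¹ : GL (Fin 3) (w.1.adicCompletion L)) : Matrix (Fin 3) (Fin 3) (w.1.adicCompletion L))
        (P : Matrix (Fin 3) (Fin 3) (w.1.adicCompletion L)),
      hPinvP, Matrix.one_mulVec, endoGL_mulVec_single_one, Matrix.mulVec_smul]
  have hlen : (∑ i : Fin 3, ∑ k : Fin 3, σ ((P : Matrix (Fin 3) (Fin 3) (w.1.adicCompletion L)) i 1) * J₀ i k * (P : Matrix (Fin 3) (Fin 3) (w.1.adicCompletion L)) k 1) = a₁ := by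
    rw [← pairing_apply, ← formCongr_apply_eq_pairing σ P J₀ 1 1, hJ₀, hP, hH₃def, endoForm_apply_one_one]
  exact ⟨P, C, d₀, d₁, a₁, hPint, hσd₀, hσd₁, hvd₀, hvd₁, hG₁, hσa₁, hva₁, ha₁N, hP, hYU, hconj, heig, col_ne_zero P 1, hlen⟩

end CM

end Summit.HodgeConjecture.HodgeConjecture.Cruxes.H413.F0P3cDyRamTypeTwoAnisotropicLiteralWild

end
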